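import Summits.Ventures.LatticeQCDFlow.Scaling.DominatedStarMixingCeiling

/-!
HONEST FRAMING: exact (Metropolis-corrected) sampling algorithms for lattice gauge theory; figures
of merit are autocorrelation/cost numbers at stated couplings and volumes; no continuum-physics
claim.

# DominatedStarLazyHotSampler — A HOT SAMPLER THAT REGENERATES ONLY WITH PROBABILITY `a` (`M_0 = (1−a)·Id + a·μ_0`)
# COSTS EXACTLY THE FACTOR `a` IN THE HOT WEIGHT: UNDER ONE-SIDED DOMINATION AND `4t ≤ p(1−t)·a·w_0` THE CEILING
# `d(n) ≤ ((2K+p)/p)(1 − tcp/(2m))ⁿ`, `t_mix(ε) ≤ ⌈(2m/(tcp))·log((2K+p)/(pε))⌉` IS UNCHANGED; WITH PERFECT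
# TRANSPORTS `d(n) ≤ 2(K+1)(1 − t(1−t)·a·w_0·c/(2m))ⁿ` (lean-2 GEN-26, ours)

Venture-side (OURS).  Cell `lqcd-flow` (pub-lqcd), unit `pub-lqcd-lean-2-g26`, 2026-08-27.  Chapter M (the
coupon-collector ceiling without perfect transports), file 16.  Setting of `Scaling/DominatedStarMixingCeiling`, except
that the hot kernel is the LAZY exact sampler `M_0(u,v) = (1−a)·𝟙{u=v} + a·μ_0(v)`, `0 < a ≤ 1` — an independence
sampler that fires with probability `a` (e.g. a perfect-sampling subroutine run on a fraction `a` of the hot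
updates).  The reduction is an identity of kernels: the idle mass `(1−a)w_0` of the hot coordinate is the identity on
configurations, which is also a `μ_{k₁}`-stationary move of any cold coordinate `k₁`; so `Π_w^M = Π_{w'}^{M'}` with
`w'_0 = a·w_0`, `w'_{k₁} = w_{k₁} + (1−a)w_0`, `M'_0` the exact sampler and `M'_{k₁}` the corresponding mixture — and
chapter M applies verbatim with `w_0` replaced by `a·w_0`.

## What is proved

* §1 **`coordKernel_lazyHot`** — `cK(M)_0 = (1−a)·𝟙{y=x} + a·cK(μ_0)_0`; **`coordKernel_absorbIdle`** —
  `w'_{k₁}·cK(M')_{k₁} = w_{k₁}·cK(M)_{k₁} + (1−a)w_0·𝟙{y=x}`; **`lazyHot_prodKernel_eq`** — `Π_w^M = Π_{w'}^{M'}`;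
  `lazyHot_weights_nonneg`, `lazyHot_weights_sum`, `lazyHot_kernels_isRowStochastic`, `lazyHot_kernels_stationary`.
* §2 **`lazyHotStar_worstTvDist_le`** — `K ≥ 1`, `0 < a ≤ 1`, one-sided domination `p·μ_{l_r}(φ_r u) ≤ μ_0(u)`
  (`0 < p ≤ 1`), `4t ≤ p(1−t)·a·w_0`, stationary cold kernels: `d(n) ≤ ((2K+p)/p)(1 − tcp/(2m))ⁿ`;
  **`lazyHotStar_mixingTime_le`** — `t_mix(ε) ≤ ⌈(2m/(tcp))·log((2K+p)/(pε))⌉`.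
* §3 **`lazyHotPerfectStar_worstTvDist_le`** — perfect transports, `0 < t < 1`, `w_0 > 0`:
  `d(n) ≤ 2(K+1)(1 − t(1−t)(a·w_0)c/(2m))ⁿ`; `lazyHotPerfectStar_mixingTime_le`.

Reading (no numerics implied): an exact hot sampler is the idealisation of chapter M; a hot kernel that is exact
only on a fraction `a` of its calls keeps every statement with the hot weight discounted to `a·w_0` — the regime
shrinks to `4t ≤ p(1−t)a·w_0` and, for perfect maps, the rate to `t(1−t)a·w_0c/(2m)`; under one-sided domination the
rate `tcp/(2m)` itself does not see `a`.  NOT CLAIMED: hot kernels that are merely fast-mixing (spectral gap `γ₀`)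
rather than exact with probability `a` — that is chapter K's regime (`Scaling/HubProposalLaw`), with `K⁻¹` losses;
anything measured.  Literature grade (cell rule): OWN RESULT; nothing cited as a fact; no new bib keys.
-/

noncomputable section

open Finset Function
open Literature.Probability.MarkovChains

namespace Summit.Ventures.LatticeQCDFlow.Scaling

variable {S : Type*} [Fintype S] [DecidableEq S] {K m : ℕ} {μ : Fin (K + 1) → S → ℝ} {M : Fin (K + 1) → S → S → ℝ}
  {w : Fin (K + 1) → ℝ} {t p a : ℝ}

section Lazy

/-! ## §1 The kernel identity -/

omit [Fintype S] [DecidableEq S] in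
/-- On configurations, `y = update x j (y j)` together with `x j = y j` is `y = x`. [ours] -/
theorem eq_update_iff_eq (x y : Fin (K + 1) → S) (j : Fin (K + 1)) :
    (y = update x j (y j) ∧ x j = y j) ↔ y = x := by
  constructor
  · rintro ⟨h1, h2⟩
    rw [h1, ← h2, update_eq_self]
  · rintro rfl
    exact ⟨(update_eq_self j y).symm, rfl⟩

omit [Fintype S] in
/-- **THE LAZY HOT COORDINATE KERNEL:** `M_0(u,v) = (1−a)𝟙{u=v} + a·μ_0(v)` gives
`cK(M)_0(x,y) = (1−a)·𝟙{y=x} + a·cK(μ_0)_0(x,y)`. [ours] -/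
theorem coordKernel_lazyHot (hM0 : ∀ u v, M 0 u v = (1 - a) * (if u = v then (1 : ℝ) else 0) + a * μ 0 v)
    (x y : Fin (K + 1) → S) :
    coordKernel M 0 x y = (1 - a) * (if y = x then (1 : ℝ) else 0)
      + a * coordKernel (fun (k : Fin (K + 1)) (_ : S) (v : S) => μ k v) 0 x y := by
  unfold coordKernel
  by_cases h : y = update x 0 (y 0)
  · rw [if_pos h, if_pos h, hM0]
    by_cases h2 : x 0 = y 0
    · rw [if_pos h2, if_pos ((eq_update_iff_eq x y 0).mp ⟨h, h2⟩)]
    · rw [if_neg h2, if_neg (fun hyx => h2 ((eq_update_iff_eq x y 0).mpr hyx).2)]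
  · rw [if_neg h, if_neg h, if_neg (fun hyx => h ((eq_update_iff_eq x y 0).mpr hyx).1)]
    ring

omit [Fintype S] in
/-- **ABSORBING THE IDLE MASS INTO A COLD COORDINATE `k₁`:** with `w'_{k₁} = w_{k₁} + (1−a)w_0` and
`M'_{k₁} = (w_{k₁}M_{k₁} + (1−a)w_0·Id)/w'_{k₁}` (or `M_{k₁}` when `w'_{k₁} = 0`, which forces both summands to vanish):
`w'_{k₁}·cK(M')_{k₁}(x,y) = w_{k₁}·cK(M)_{k₁}(x,y) + (1−a)w_0·𝟙{y=x}`. [ours] -/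
theorem coordKernel_absorbIdle (hw0 : ∀ k, 0 ≤ w k) (ha1 : a ≤ 1) (k₁ : Fin (K + 1))
    {M' : Fin (K + 1) → S → S → ℝ}
    (hM' : ∀ u v, M' k₁ u v = if w k₁ + (1 - a) * w 0 = 0 then M k₁ u v
      else (w k₁ * M k₁ u v + (1 - a) * w 0 * (if u = v then (1 : ℝ) else 0)) / (w k₁ + (1 - a) * w 0))
    (x y : Fin (K + 1) → S) :
    (w k₁ + (1 - a) * w 0) * coordKernel M' k₁ x y
      = w k₁ * coordKernel M k₁ x y + (1 - a) * w 0 * (if y = x then (1 : ℝ) else 0) := by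
  have hnn1 : 0 ≤ w k₁ := hw0 k₁
  have hnn2 : 0 ≤ (1 - a) * w 0 := mul_nonneg (by linarith) (hw0 0)
  unfold coordKernel
  by_cases hz : w k₁ + (1 - a) * w 0 = 0
  · have h1 : w k₁ = 0 := by linarith
    have h2 : (1 - a) * w 0 = 0 := by linarith
    rw [hz, h1, h2]; ring
  · by_cases h : y = update x k₁ (y k₁)
    · rw [if_pos h, if_pos h, hM', if_neg hz, mul_div_cancel₀ _ hz]
      by_cases h2 : x k₁ = y k₁
      · rw [if_pos h2, if_pos ((eq_update_iff_eq x y k₁).mp ⟨h, h2⟩)]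
      · rw [if_neg h2, if_neg (fun hyx => h2 ((eq_update_iff_eq x y k₁).mpr hyx).2)]
    · rw [if_neg h, if_neg h, if_neg (fun hyx => h ((eq_update_iff_eq x y k₁).mpr hyx).1)]
      ring

omit [Fintype S] in
/-- **THE KERNEL IDENTITY `Π_w^M = Π_{w'}^{M'}`** for the lazy hot sampler and the absorbed weights/kernels. [ours] -/
theorem lazyHot_prodKernel_eq (hw0 : ∀ k, 0 ≤ w k) (ha1 : a ≤ 1)
    (hM0 : ∀ u v, M 0 u v = (1 - a) * (if u = v then (1 : ℝ) else 0) + a * μ 0 v)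
    {k₁ : Fin (K + 1)} (hk₁ : k₁ ≠ 0) {w' : Fin (K + 1) → ℝ}
    (hw' : ∀ k, w' k = if k = 0 then a * w 0 else if k = k₁ then w k₁ + (1 - a) * w 0 else w k)
    {M' : Fin (K + 1) → S → S → ℝ}
    (hM' : ∀ k u v, M' k u v = if k = 0 then μ 0 v else if k = k₁ then
      (if w k₁ + (1 - a) * w 0 = 0 then M k₁ u v
        else (w k₁ * M k₁ u v + (1 - a) * w 0 * (if u = v then (1 : ℝ) else 0)) / (w k₁ + (1 - a) * w 0))
      else M k u v) :
    prodKernel w M = prodKernel w' M' := by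
  funext x y
  unfold prodKernel
  -- coordinate kernels agree off `{0, k₁}`; the two special terms recombine
  have hcK : ∀ k, k ≠ 0 → k ≠ k₁ → coordKernel M' k x y = coordKernel M k x y := by
    intro k hk0 hk1
    unfold coordKernel
    rw [hM' k, if_neg hk0, if_neg hk1]
  have hcK0 : coordKernel M' 0 x y = coordKernel (fun (k : Fin (K + 1)) (_ : S) (v : S) => μ k v) 0 x y := by
    unfold coordKernel
    rw [hM' 0, if_pos rfl]
  have hM'k₁ : ∀ u v, M' k₁ u v = if w k₁ + (1 - a) * w 0 = 0 then M k₁ u v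
      else (w k₁ * M k₁ u v + (1 - a) * w 0 * (if u = v then (1 : ℝ) else 0)) / (w k₁ + (1 - a) * w 0) := by
    intro u v; rw [hM' k₁, if_neg hk₁, if_pos rfl]
  have hk₁term := coordKernel_absorbIdle hw0 ha1 k₁ hM'k₁ x y
  have h0term := coordKernel_lazyHot (μ := μ) hM0 x y
  -- the difference of the two sums is supported on `{0, k₁}` and cancels there
  have hdiff : ∑ k, (w' k * coordKernel M' k x y - w k * coordKernel M k x y) = 0 := by
    rw [Fintype.sum_eq_add 0 k₁ (Ne.symm hk₁) (fun k hk => by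
      rw [hw' k, if_neg hk.1, if_neg hk.2, hcK k hk.1 hk.2, sub_self])]
    rw [hw' 0, if_pos rfl, hw' k₁, if_neg hk₁, if_pos rfl, hcK0, hk₁term, h0term]
    ring
  rw [Finset.sum_sub_distrib] at hdiff
  linarith

/-- The absorbed weights are non-negative (`0 ≤ a ≤ 1`, `w ≥ 0`). [ours] -/
theorem lazyHot_weights_nonneg (hw0 : ∀ k, 0 ≤ w k) (ha0 : 0 ≤ a) (ha1 : a ≤ 1) {k₁ : Fin (K + 1)}
    {w' : Fin (K + 1) → ℝ}
    (hw' : ∀ k, w' k = if k = 0 then a * w 0 else if k = k₁ then w k₁ + (1 - a) * w 0 else w k) (k : Fin (K + 1)) :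
    0 ≤ w' k := by
  rw [hw' k]
  split_ifs
  · exact mul_nonneg ha0 (hw0 0)
  · exact add_nonneg (hw0 k₁) (mul_nonneg (by linarith) (hw0 0))
  · exact hw0 k

/-- The absorbed weights sum to one (`k₁ ≠ 0`). [ours] -/
theorem lazyHot_weights_sum (hw1 : ∑ k, w k = 1) {k₁ : Fin (K + 1)} (hk₁ : k₁ ≠ 0) {w' : Fin (K + 1) → ℝ}
    (hw' : ∀ k, w' k = if k = 0 then a * w 0 else if k = k₁ then w k₁ + (1 - a) * w 0 else w k) :
    ∑ k, w' k = 1 := by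
  have hdiff : ∑ k, (w' k - w k) = 0 := by
    rw [Fintype.sum_eq_add 0 k₁ (Ne.symm hk₁) (fun k hk => by rw [hw' k, if_neg hk.1, if_neg hk.2, sub_self])]
    rw [hw' 0, if_pos rfl, hw' k₁, if_neg hk₁, if_pos rfl]
    ring
  rw [Finset.sum_sub_distrib, hw1] at hdiff
  linarith

/-- The absorbed kernels are transition matrices (`μ_0` a positive probability vector, the `M_k` transition matrices,
`0 ≤ a ≤ 1`, `w ≥ 0`). [ours] -/
theorem lazyHot_kernels_isRowStochastic (hw0 : ∀ k, 0 ≤ w k) (ha1 : a ≤ 1) (hμ : ∀ k x, 0 < μ k x)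
    (hμ1 : ∀ k, ∑ u, μ k u = 1) (hM : ∀ k, IsRowStochastic (M k)) {k₁ : Fin (K + 1)}
    {M' : Fin (K + 1) → S → S → ℝ}
    (hM' : ∀ k u v, M' k u v = if k = 0 then μ 0 v else if k = k₁ then
      (if w k₁ + (1 - a) * w 0 = 0 then M k₁ u v
        else (w k₁ * M k₁ u v + (1 - a) * w 0 * (if u = v then (1 : ℝ) else 0)) / (w k₁ + (1 - a) * w 0))
      else M k u v) (k : Fin (K + 1)) :
    IsRowStochastic (M' k) := by
  have hnn2 : 0 ≤ (1 - a) * w 0 := mul_nonneg (by linarith) (hw0 0)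
  by_cases h0 : k = 0
  · have hrow : ∀ u v, M' k u v = μ 0 v := fun u v => by rw [hM', if_pos h0]
    exact ⟨fun u v => by rw [hrow]; exact (hμ 0 v).le, fun u => by simp_rw [hrow]; exact hμ1 0⟩
  · by_cases h1 : k = k₁
    · by_cases hz : w k₁ + (1 - a) * w 0 = 0
      · have hrow : ∀ u v, M' k u v = M k₁ u v := fun u v => by rw [hM', if_neg h0, if_pos h1, if_pos hz]
        exact ⟨fun u v => by rw [hrow]; exact (hM k₁).1 u v, fun u => by simp_rw [hrow]; exact (hM k₁).2 u⟩
      · have hrow : ∀ u v, M' k u v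
            = (w k₁ * M k₁ u v + (1 - a) * w 0 * (if u = v then (1 : ℝ) else 0)) / (w k₁ + (1 - a) * w 0) :=
          fun u v => by rw [hM', if_neg h0, if_pos h1, if_neg hz]
        refine ⟨fun u v => ?_, fun u => ?_⟩
        · rw [hrow]
          have hind : (0 : ℝ) ≤ (if u = v then (1 : ℝ) else 0) := by split_ifs <;> norm_num
          exact div_nonneg (add_nonneg (mul_nonneg (hw0 k₁) ((hM k₁).1 u v)) (mul_nonneg hnn2 hind))
            (add_nonneg (hw0 k₁) hnn2)
        · simp_rw [hrow]
          rw [← Finset.sum_div, Finset.sum_add_distrib, ← Finset.mul_sum, ← Finset.mul_sum, (hM k₁).2 u,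
            Finset.sum_ite_eq univ u (fun _ => (1 : ℝ)), if_pos (mem_univ _), mul_one, mul_one]
          exact div_self hz
    · have hrow : ∀ u v, M' k u v = M k u v := fun u v => by rw [hM', if_neg h0, if_neg h1]
      exact ⟨fun u v => by rw [hrow]; exact (hM k).1 u v, fun u => by simp_rw [hrow]; exact (hM k).2 u⟩

omit [Fintype S] in
/-- The hot absorbed kernel is the exact sampler. [ours] -/
theorem lazyHot_kernels_zero {k₁ : Fin (K + 1)} {M' : Fin (K + 1) → S → S → ℝ}
    (hM' : ∀ k u v, M' k u v = if k = 0 then μ 0 v else if k = k₁ then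
      (if w k₁ + (1 - a) * w 0 = 0 then M k₁ u v
        else (w k₁ * M k₁ u v + (1 - a) * w 0 * (if u = v then (1 : ℝ) else 0)) / (w k₁ + (1 - a) * w 0))
      else M k u v) (u v : S) :
    M' 0 u v = μ 0 v := by
  rw [hM' 0, if_pos rfl]

/-- The cold absorbed kernels are `μ_k`-stationary when the `M_k` (`k ≠ 0`) are. [ours] -/
theorem lazyHot_kernels_stationary (hstat : ∀ k : Fin (K + 1), k ≠ 0 → ∀ v, ∑ u, μ k u * M k u v = μ k v)
    {k₁ : Fin (K + 1)} {M' : Fin (K + 1) → S → S → ℝ}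
    (hM' : ∀ k u v, M' k u v = if k = 0 then μ 0 v else if k = k₁ then
      (if w k₁ + (1 - a) * w 0 = 0 then M k₁ u v
        else (w k₁ * M k₁ u v + (1 - a) * w 0 * (if u = v then (1 : ℝ) else 0)) / (w k₁ + (1 - a) * w 0))
      else M k u v) (k : Fin (K + 1)) (hk : k ≠ 0) (v : S) :
    ∑ u, μ k u * M' k u v = μ k v := by
  by_cases h1 : k = k₁
  · by_cases hz : w k₁ + (1 - a) * w 0 = 0
    · have hrow : ∀ u, M' k u v = M k u v := fun u => by rw [hM', if_neg hk, if_pos h1, if_pos hz, h1]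
      rw [Finset.sum_congr rfl fun u _ => by rw [hrow u]]
      exact hstat k hk v
    · have hrow : ∀ u, M' k u v
          = (w k * M k u v + (1 - a) * w 0 * (if u = v then (1 : ℝ) else 0)) / (w k + (1 - a) * w 0) := by
        intro u; rw [hM', if_neg hk, if_pos h1, if_neg hz, h1]
      have hz' : w k + (1 - a) * w 0 ≠ 0 := by rw [h1]; exact hz
      rw [Finset.sum_congr rfl fun u _ => by rw [hrow u]]
      have hI : ∑ u, μ k u * ((1 - a) * w 0 * (if u = v then (1 : ℝ) else 0)) = (1 - a) * w 0 * μ k v := by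
        rw [Finset.sum_eq_single v (fun u _ hu => by rw [if_neg hu]; ring) (fun h => absurd (mem_univ v) h),
          if_pos rfl]; ring
      calc ∑ u, μ k u * ((w k * M k u v + (1 - a) * w 0 * (if u = v then (1 : ℝ) else 0)) / (w k + (1 - a) * w 0))
          = (w k * ∑ u, μ k u * M k u v + ∑ u, μ k u * ((1 - a) * w 0 * (if u = v then (1 : ℝ) else 0)))
              / (w k + (1 - a) * w 0) := by
            rw [Finset.mul_sum, ← Finset.sum_add_distrib, Finset.sum_div]
            exact Finset.sum_congr rfl fun u _ => by ring
        _ = μ k v := by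
            rw [hstat k hk v, hI]
            field_simp
  · have hrow : ∀ u, M' k u v = M k u v := fun u => by rw [hM', if_neg hk, if_neg h1]
    rw [Finset.sum_congr rfl fun u _ => by rw [hrow u]]
    exact hstat k hk v

end Lazy

section Scheme
variable (κ : Fin m → Fin K) (φ : Fin m → Equiv.Perm S)

/-! ## §2 One-sided domination with a lazy hot sampler -/

/-- **THE CEILING WITH A LAZY HOT SAMPLER:** `K ≥ 1`, `M_0(u,v) = (1−a)𝟙{u=v} + a·μ_0(v)` with `0 < a ≤ 1`, one-sided
domination `p·μ_{l_r}(φ_r u) ≤ μ_0(u)` (`0 < p ≤ 1`), **`4t ≤ p(1−t)·a·w_0`**, `μ_k`-stationary cold kernels, hub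
multiplicities `≥ c ≥ 1`: **`d(n) ≤ ((2K+p)/p)·(1 − tcp/(2m))ⁿ`** — the rate does not see `a`. [ours] -/
theorem lazyHotStar_worstTvDist_le (hK : 1 ≤ K) (hm : 1 ≤ m) (ht0 : 0 ≤ t) (ht1 : t ≤ 1) (hw0 : ∀ k, 0 ≤ w k)
    (hw1 : ∑ k, w k = 1) (hμ : ∀ k x, 0 < μ k x) (hμ1 : ∀ k, ∑ u, μ k u = 1) (hM : ∀ k, IsRowStochastic (M k))
    (ha0 : 0 < a) (ha1 : a ≤ 1) (hM0 : ∀ u v, M 0 u v = (1 - a) * (if u = v then (1 : ℝ) else 0) + a * μ 0 v)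
    (hstat : ∀ k : Fin (K + 1), k ≠ 0 → ∀ v, ∑ u, μ k u * M k u v = μ k v)
    (hp0 : 0 < p) (hp1 : p ≤ 1) (hdom : ∀ r u, p * μ (κ r).succ (φ r u) ≤ μ 0 u) (hreg : 4 * t ≤ p * (1 - t) * (a * w 0))
    {c : ℕ} (hc1 : 1 ≤ c) (hc : ∀ p' : Fin K, c ≤ (univ.filter (fun r : Fin m => κ r = p')).card) (hcm : c ≤ m)
    (n : ℕ) :
    worstTvDist (fun y z : Fin (K + 1) → S =>
        t * ptGraphSwap μ (fun r : Fin m => (((0 : Fin (K + 1)), (κ r).succ) : Fin (K + 1) × Fin (K + 1))) φ y z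
          + (1 - t) * prodKernel w M y z) (tensorFun μ) n
      ≤ (2 * (K : ℝ) + p) / p * (1 - t * c * p / (2 * m)) ^ n := by
  -- absorb the idle hot mass into the cold coordinate `k₁ = 1`
  set k₁ : Fin (K + 1) := (⟨0, by omega⟩ : Fin K).succ with hk₁_def
  have hk₁ : k₁ ≠ 0 := Fin.succ_ne_zero _
  set w' : Fin (K + 1) → ℝ := fun k => if k = 0 then a * w 0 else if k = k₁ then w k₁ + (1 - a) * w 0 else w k
    with hw'_def
  have hw' : ∀ k, w' k = if k = 0 then a * w 0 else if k = k₁ then w k₁ + (1 - a) * w 0 else w k := fun _ => rfl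
  set M' : Fin (K + 1) → S → S → ℝ := fun k u v => if k = 0 then μ 0 v else if k = k₁ then
      (if w k₁ + (1 - a) * w 0 = 0 then M k₁ u v
        else (w k₁ * M k₁ u v + (1 - a) * w 0 * (if u = v then (1 : ℝ) else 0)) / (w k₁ + (1 - a) * w 0))
      else M k u v with hM'_def
  have hM' : ∀ k u v, M' k u v = if k = 0 then μ 0 v else if k = k₁ then
      (if w k₁ + (1 - a) * w 0 = 0 then M k₁ u v
        else (w k₁ * M k₁ u v + (1 - a) * w 0 * (if u = v then (1 : ℝ) else 0)) / (w k₁ + (1 - a) * w 0))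
      else M k u v := fun _ _ _ => rfl
  have hPK := lazyHot_prodKernel_eq (μ := μ) hw0 ha1 hM0 hk₁ hw' hM'
  have hreg' : 4 * t ≤ p * (1 - t) * w' 0 := by rw [hw' 0, if_pos rfl]; exact hreg
  have h := dominatedStar_worstTvDist_le_oneSided κ φ (w := w') (M := M') hm ht0 ht1
    (lazyHot_weights_nonneg hw0 ha0.le ha1 hw') (lazyHot_weights_sum hw1 hk₁ hw') hμ hμ1
    (lazyHot_kernels_isRowStochastic hw0 ha1 hμ hμ1 hM hM') (lazyHot_kernels_zero hM')
    (lazyHot_kernels_stationary hstat hM') hp0 hp1 hdom hreg' hc1 hc hcm n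
  rw [← hPK] at h
  exact h

/-- **`t_mix(ε) ≤ ⌈(2m/(tcp))·log((2K+p)/(pε))⌉` WITH A LAZY HOT SAMPLER** (`0 < t`, `4t ≤ p(1−t)·a·w_0`). [ours] -/
theorem lazyHotStar_mixingTime_le (hK : 1 ≤ K) (hm : 1 ≤ m) (ht0 : 0 < t) (ht1 : t ≤ 1) (hw0 : ∀ k, 0 ≤ w k)
    (hw1 : ∑ k, w k = 1) (hμ : ∀ k x, 0 < μ k x) (hμ1 : ∀ k, ∑ u, μ k u = 1) (hM : ∀ k, IsRowStochastic (M k))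
    (ha0 : 0 < a) (ha1 : a ≤ 1) (hM0 : ∀ u v, M 0 u v = (1 - a) * (if u = v then (1 : ℝ) else 0) + a * μ 0 v)
    (hstat : ∀ k : Fin (K + 1), k ≠ 0 → ∀ v, ∑ u, μ k u * M k u v = μ k v)
    (hp0 : 0 < p) (hp1 : p ≤ 1) (hdom : ∀ r u, p * μ (κ r).succ (φ r u) ≤ μ 0 u) (hreg : 4 * t ≤ p * (1 - t) * (a * w 0))
    {c : ℕ} (hc1 : 1 ≤ c) (hc : ∀ p' : Fin K, c ≤ (univ.filter (fun r : Fin m => κ r = p')).card) (hcm : c ≤ m)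
    {ε : ℝ} (hε : 0 < ε) :
    mixingTime (fun y z : Fin (K + 1) → S =>
        t * ptGraphSwap μ (fun r : Fin m => (((0 : Fin (K + 1)), (κ r).succ) : Fin (K + 1) × Fin (K + 1))) φ y z
          + (1 - t) * prodKernel w M y z) (tensorFun μ) ε
      ≤ ⌈2 * (m : ℝ) / (t * c * p) * Real.log ((2 * (K : ℝ) + p) / (p * ε))⌉₊ := by
  have hmpos : (0 : ℝ) < m := Nat.cast_pos.mpr (by omega)
  have hcpos : (0 : ℝ) < c := Nat.cast_pos.mpr (by omega)
  have hcm' : (c : ℝ) ≤ m := by exact_mod_cast hcm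
  refine mixingTime_le _ _ ((lazyHotStar_worstTvDist_le κ φ hK hm ht0.le ht1 hw0 hw1 hμ hμ1 hM ha0 ha1 hM0 hstat hp0
    hp1 hdom hreg hc1 hc hcm _).trans ?_)
  have ha0' : 0 < t * c * p / (2 * m) := by positivity
  have ha1' : t * c * p / (2 * m) ≤ 1 := by
    rw [div_le_one (by positivity)]
    have h1 : t * c ≤ 1 * m := by nlinarith
    nlinarith
  have hC : 0 < (2 * (K : ℝ) + p) / p := by positivity
  refine geom_le_of_ge_log ha0' ha1' hC hε ?_
  have e1 : 1 / (t * c * p / (2 * m)) = 2 * (m : ℝ) / (t * c * p) := by field_simp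
  have e2 : (2 * (K : ℝ) + p) / p / ε = (2 * (K : ℝ) + p) / (p * ε) := by rw [div_div]
  rw [e1, e2]
  exact Nat.le_ceil _

/-! ## §3 Perfect transports with a lazy hot sampler -/

/-- **PERFECT TRANSPORTS WITH A LAZY HOT SAMPLER: `d(n) ≤ 2(K+1)·(1 − t(1−t)(a·w_0)c/(2m))ⁿ`** (`K ≥ 1`, `0 < t < 1`,
`w_0 > 0`, `0 < a ≤ 1`, any laws, maps, weights; stationary cold kernels). [ours] -/
theorem lazyHotPerfectStar_worstTvDist_le (hK : 1 ≤ K) (hm : 1 ≤ m) (ht0 : 0 < t) (ht1 : t < 1)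
    (hw0 : ∀ k, 0 ≤ w k) (hw00 : 0 < w 0) (hw1 : ∑ k, w k = 1) (hμ : ∀ k x, 0 < μ k x) (hμ1 : ∀ k, ∑ u, μ k u = 1)
    (hM : ∀ k, IsRowStochastic (M k)) (ha0 : 0 < a) (ha1 : a ≤ 1)
    (hM0 : ∀ u v, M 0 u v = (1 - a) * (if u = v then (1 : ℝ) else 0) + a * μ 0 v)
    (hstat : ∀ k : Fin (K + 1), k ≠ 0 → ∀ v, ∑ u, μ k u * M k u v = μ k v) (hperf : ∀ r u, μ (κ r).succ (φ r u) = μ 0 u)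
    {c : ℕ} (hc1 : 1 ≤ c) (hc : ∀ p' : Fin K, c ≤ (univ.filter (fun r : Fin m => κ r = p')).card) (hcm : c ≤ m)
    (n : ℕ) :
    worstTvDist (fun y z : Fin (K + 1) → S =>
        t * ptGraphSwap μ (fun r : Fin m => (((0 : Fin (K + 1)), (κ r).succ) : Fin (K + 1) × Fin (K + 1))) φ y z
          + (1 - t) * prodKernel w M y z) (tensorFun μ) n
      ≤ 2 * ((K : ℝ) + 1) * (1 - t * (1 - t) * (a * w 0) * c / (2 * m)) ^ n := by
  set k₁ : Fin (K + 1) := (⟨0, by omega⟩ : Fin K).succ with hk₁_def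
  have hk₁ : k₁ ≠ 0 := Fin.succ_ne_zero _
  set w' : Fin (K + 1) → ℝ := fun k => if k = 0 then a * w 0 else if k = k₁ then w k₁ + (1 - a) * w 0 else w k
    with hw'_def
  have hw' : ∀ k, w' k = if k = 0 then a * w 0 else if k = k₁ then w k₁ + (1 - a) * w 0 else w k := fun _ => rfl
  set M' : Fin (K + 1) → S → S → ℝ := fun k u v => if k = 0 then μ 0 v else if k = k₁ then
      (if w k₁ + (1 - a) * w 0 = 0 then M k₁ u v
        else (w k₁ * M k₁ u v + (1 - a) * w 0 * (if u = v then (1 : ℝ) else 0)) / (w k₁ + (1 - a) * w 0))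
      else M k u v with hM'_def
  have hM' : ∀ k u v, M' k u v = if k = 0 then μ 0 v else if k = k₁ then
      (if w k₁ + (1 - a) * w 0 = 0 then M k₁ u v
        else (w k₁ * M k₁ u v + (1 - a) * w 0 * (if u = v then (1 : ℝ) else 0)) / (w k₁ + (1 - a) * w 0))
      else M k u v := fun _ _ _ => rfl
  have hPK := lazyHot_prodKernel_eq (μ := μ) hw0 ha1 hM0 hk₁ hw' hM'
  have hw0' : 0 < w' 0 := by rw [hw' 0, if_pos rfl]; exact mul_pos ha0 hw00
  have h := perfectStar_worstTvDist_le κ φ (w := w') (M := M') hm ht0 ht1 (lazyHot_weights_nonneg hw0 ha0.le ha1 hw')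
    hw0' (lazyHot_weights_sum hw1 hk₁ hw') hμ hμ1 (lazyHot_kernels_isRowStochastic hw0 ha1 hμ hμ1 hM hM')
    (lazyHot_kernels_zero hM') (lazyHot_kernels_stationary hstat hM') hperf hc1 hc hcm n
  rw [← hPK, hw' 0, if_pos rfl] at h
  exact h

/-- **`t_mix(ε) ≤ ⌈(2m/(t(1−t)(a·w_0)c))·log(2(K+1)/ε)⌉` WITH PERFECT TRANSPORTS AND A LAZY HOT SAMPLER.** [ours] -/
theorem lazyHotPerfectStar_mixingTime_le (hK : 1 ≤ K) (hm : 1 ≤ m) (ht0 : 0 < t) (ht1 : t < 1)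
    (hw0 : ∀ k, 0 ≤ w k) (hw00 : 0 < w 0) (hw1 : ∑ k, w k = 1) (hμ : ∀ k x, 0 < μ k x) (hμ1 : ∀ k, ∑ u, μ k u = 1)
    (hM : ∀ k, IsRowStochastic (M k)) (ha0 : 0 < a) (ha1 : a ≤ 1)
    (hM0 : ∀ u v, M 0 u v = (1 - a) * (if u = v then (1 : ℝ) else 0) + a * μ 0 v)
    (hstat : ∀ k : Fin (K + 1), k ≠ 0 → ∀ v, ∑ u, μ k u * M k u v = μ k v) (hperf : ∀ r u, μ (κ r).succ (φ r u) = μ 0 u)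
    {c : ℕ} (hc1 : 1 ≤ c) (hc : ∀ p' : Fin K, c ≤ (univ.filter (fun r : Fin m => κ r = p')).card) (hcm : c ≤ m)
    {ε : ℝ} (hε : 0 < ε) :
    mixingTime (fun y z : Fin (K + 1) → S =>
        t * ptGraphSwap μ (fun r : Fin m => (((0 : Fin (K + 1)), (κ r).succ) : Fin (K + 1) × Fin (K + 1))) φ y z
          + (1 - t) * prodKernel w M y z) (tensorFun μ) ε
      ≤ ⌈2 * (m : ℝ) / (t * (1 - t) * (a * w 0) * c) * Real.log (2 * ((K : ℝ) + 1) / ε)⌉₊ := by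
  have hmpos : (0 : ℝ) < m := Nat.cast_pos.mpr (by omega)
  have hcpos : (0 : ℝ) < c := Nat.cast_pos.mpr (by omega)
  have hcm' : (c : ℝ) ≤ m := by exact_mod_cast hcm
  have h1t : 0 < 1 - t := by linarith
  have haw : 0 < a * w 0 := mul_pos ha0 hw00
  have hw01 : w 0 ≤ 1 := by
    have h := Finset.single_le_sum (f := w) (fun k _ => hw0 k) (mem_univ (0 : Fin (K + 1)))
    rw [hw1] at h; exact h
  have haw1 : a * w 0 ≤ 1 := by nlinarith
  refine mixingTime_le _ _ ((lazyHotPerfectStar_worstTvDist_le κ φ hK hm ht0 ht1 hw0 hw00 hw1 hμ hμ1 hM ha0 ha1 hM0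
    hstat hperf hc1 hc hcm _).trans ?_)
  have hb0 : 0 < t * (1 - t) * (a * w 0) * c / (2 * m) := by positivity
  have hb1 : t * (1 - t) * (a * w 0) * c / (2 * m) ≤ 1 := by
    rw [div_le_one (by positivity)]
    have h1 : t * (1 - t) ≤ 1 := by nlinarith
    have h2 : t * (1 - t) * (a * w 0) ≤ 1 := by nlinarith
    nlinarith
  have hC : 0 < 2 * ((K : ℝ) + 1) := by positivity
  refine geom_le_of_ge_log hb0 hb1 hC hε ?_
  have e1 : 1 / (t * (1 - t) * (a * w 0) * c / (2 * m)) = 2 * (m : ℝ) / (t * (1 - t) * (a * w 0) * c) := by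
    field_simp
  rw [e1]
  exact Nat.le_ceil _

end Scheme

end Summit.Ventures.LatticeQCDFlow.Scaling

end
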